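import Mathlib.Analysis.SpecialFunctions.Log.Deriv
import Mathlib.Analysis.SpecialFunctions.Sqrt
import Mathlib.Analysis.SpecialFunctions.Trigonometric.Deriv
import Mathlib.Analysis.Calculus.MeanValue
import Literature.Analysis.FluidPDE.PineauVicolRSS
import Literature.Analysis.FluidPDE.TypeIAncientMild
import Literature.Analysis.FluidPDE.SwirlTransportProofs
import Literature.Analysis.FluidPDE.WeakSolution
import HarnessLib

/-!
# Route TypeICertificateLadder — crux `Target` (item stmt-NavierStokesRegularity-1217),
# line `killing-twisted-bernoulli-solitons`: integrating the spiral-scaling generator clause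
# along the group orbit (sub-goal SB4a, stub `solitonBridge_pvAnsatz_of_generator`)

Helper file (theorems only). Converse of the sibling stub `solitonBridge_generator` (SB2). A field
`u` of the rate class `A_C` (`IsTypeIAncientMild C u`; only its joint smoothness on the open slab
`(−∞, 0) × ℝ³` is used) which is annihilated at EVERY `(t, x)`, `t < 0`, by the generator of the
one-parameter spiral-scaling group `v ↦ μ R(2α log μ) v(μ²·, μ R(−2α log μ)·)`,
`D(u t)(x)[x + A x] + u t x + 2t ∂ₜu(t, x) − A (u t x) = 0`, `A = (−2α) J` (`J = rotGenL` the
generator of the rotations `R = rotZ` about `e₃`), is invariant under the whole group, hence is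
the Pineau–Vicol rotated self-similar (RSS) ansatz field (arXiv:2607.09619, (1.7)) of its own
slice at `t = −1`: `u(t, x) = (−t)^{−1/2} R(αs) U(R(−αs) x/√(−t))`, `s = −log(−t)`,
`U = u(−1, ·)`, i.e. `u t x = pvAnsatz α (fun y _ => u (-1) y) t x`.

## Proof

Fix `t < 0`, `x`. The orbit `g(μ) = R(2α log μ) (μ u(μ² t, μ R(−2α log μ) x))`, `μ > 0`, has
`g(1) = u(t, x)`, and its derivative at `μ = 1` is the clause at `(t, x)` (chain rule through the
jointly `C¹` field, exactly the computation of the sibling file, plus the velocity `2α J` of the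
outer rotation), hence vanishes. The group law `g(μ₀ν) = R(2α log μ₀)(μ₀ g'(ν))`, with `g'` the
orbit through the moved point `(μ₀² t, μ₀ R(−2α log μ₀) x)`, transports this to every `μ₀ > 0`
(the clause holds at the moved point too), so `g` is constant on the connected open set `(0, ∞)`
(`IsOpen.is_const_of_deriv_eq_zero`). Evaluating at `μ = (−t)^{−1/2}` (`μ² t = −1`,
`2α log μ = −α log(−t) = αs`) gives (1.7) literally.

All statements are folklore calculus about the explicit formula (1.7).

## References

* B. Pineau, V. Vicol, arXiv:2607.09619 (2026): §1.2, (1.6)–(1.7), Remark 1.5. [PineauVicol2026]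
-/

noncomputable section

-- the summit and its single sub-problem share the name (CONVENTIONS §1), as in every Theorems file
set_option linter.dupNamespace false

namespace Summit.NavierStokesRegularity.NavierStokesRegularity.Theorems

open Set Function Filter
open scoped Topology ContDiff
open Literature.Analysis.FluidPDE

/-! ## The rotation about the axis: linearity, expansion through the generator, derivatives -/

/-- The rotation about the axis commutes with scalars: `R_θ (c • v) = c • R_θ v`. [folklore] -/
private theorem solitonBridge_orbit_rotZ_smul (θ c : ℝ) (v : EuclideanSpace ℝ (Fin 3)) :
    rotZ θ (c • v) = c • rotZ θ v := by
  ext i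
  fin_cases i <;> simp <;> ring

/-- The rotation about the axis through its (continuous linear) generator:
`R_θ v = v + sin θ • Jv + (1 − cos θ) • J(Jv)` (`J = rotGenL`). [folklore] -/
private theorem solitonBridge_orbit_rotZ_eq_rotGenL (θ : ℝ) (v : EuclideanSpace ℝ (Fin 3)) :
    rotZ θ v = v + Real.sin θ • rotGenL v + (1 - Real.cos θ) • rotGenL (rotGenL v) := by
  ext i
  fin_cases i <;> simp [rotZ, rotGen] <;> ring

/-- A fixed rotation of a differentiable curve: `(R_θ F)' = R_θ F'` (`R_θ` is linear).
[folklore] -/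
private theorem solitonBridge_orbit_hasDerivAt_rotZ_const (θ : ℝ)
    {F : ℝ → EuclideanSpace ℝ (Fin 3)} {F' : EuclideanSpace ℝ (Fin 3)} {ν₀ : ℝ}
    (hF : HasDerivAt F F' ν₀) :
    HasDerivAt (fun ν : ℝ => rotZ θ (F ν)) (rotZ θ F') ν₀ := by
  have e : (fun ν : ℝ => rotZ θ (F ν)) = fun ν =>
      F ν + Real.sin θ • rotGenL (F ν) + (1 - Real.cos θ) • rotGenL (rotGenL (F ν)) :=
    funext fun ν => solitonBridge_orbit_rotZ_eq_rotGenL _ _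
  rw [e, solitonBridge_orbit_rotZ_eq_rotGenL θ F']
  have hJ : HasDerivAt (fun ν : ℝ => rotGenL (F ν)) (rotGenL F') ν₀ :=
    rotGenL.hasFDerivAt.comp_hasDerivAt ν₀ hF
  have hJJ : HasDerivAt (fun ν : ℝ => rotGenL (rotGenL (F ν))) (rotGenL (rotGenL F')) ν₀ :=
    rotGenL.hasFDerivAt.comp_hasDerivAt ν₀ hJ
  exact (hF.add (hJ.const_smul (Real.sin θ))).add (hJJ.const_smul (1 - Real.cos θ))

/-- The spiral of a differentiable curve at the identity: the curve `ν ↦ R(2α log ν) W(ν)` has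
velocity `(2α) • J W(1) + W'(1)` at `ν = 1`. [folklore] -/
private theorem solitonBridge_orbit_hasDerivAt_spiral (α : ℝ)
    {W : ℝ → EuclideanSpace ℝ (Fin 3)} {W₁ : EuclideanSpace ℝ (Fin 3)} (hW : HasDerivAt W W₁ 1) :
    HasDerivAt (fun ν : ℝ => rotZ (2 * α * Real.log ν) (W ν)) ((2 * α) • rotGen (W 1) + W₁) 1 := by
  have e : (fun ν : ℝ => rotZ (2 * α * Real.log ν) (W ν)) = fun ν =>
      W ν + Real.sin (2 * α * Real.log ν) • rotGenL (W ν)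
        + (1 - Real.cos (2 * α * Real.log ν)) • rotGenL (rotGenL (W ν)) :=
    funext fun ν => solitonBridge_orbit_rotZ_eq_rotGenL _ _
  rw [e]
  have hθ : HasDerivAt (fun ν : ℝ => 2 * α * Real.log ν) (2 * α) 1 := by
    simpa using (Real.hasDerivAt_log (one_ne_zero : (1 : ℝ) ≠ 0)).const_mul (2 * α)
  have hsin : HasDerivAt (fun ν : ℝ => Real.sin (2 * α * Real.log ν))
      (Real.cos (2 * α * Real.log 1) * (2 * α)) 1 :=
    (Real.hasDerivAt_sin _).comp 1 hθ
  have hcos : HasDerivAt (fun ν : ℝ => 1 - Real.cos (2 * α * Real.log ν))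
      (-(-Real.sin (2 * α * Real.log 1) * (2 * α))) 1 :=
    ((Real.hasDerivAt_cos _).comp 1 hθ).const_sub 1
  have hJ : HasDerivAt (fun ν : ℝ => rotGenL (W ν)) (rotGenL W₁) 1 :=
    rotGenL.hasFDerivAt.comp_hasDerivAt 1 hW
  have hJJ : HasDerivAt (fun ν : ℝ => rotGenL (rotGenL (W ν))) (rotGenL (rotGenL W₁)) 1 :=
    rotGenL.hasFDerivAt.comp_hasDerivAt 1 hJ
  have hsum := (hW.add (hsin.smul hJ)).add (hcos.smul hJJ)
  refine hsum.congr_deriv ?_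
  simp [Real.log_one]
  abel

/-! ## Calculus on the open slab `(-∞, 0) × ℝ³` for jointly `C¹` fields -/

/-- A field jointly `C¹` on the open slab `(-∞, 0) × ℝ³` has a Fréchet derivative (its `fderiv`)
at every point `(t, x)` with `t < 0`. [folklore] -/
private theorem solitonBridge_orbit_hasFDerivAt_uncurry
    {u : ℝ → EuclideanSpace ℝ (Fin 3) → EuclideanSpace ℝ (Fin 3)}
    (h : ContDiffOn ℝ 1 (uncurry u) (Iio 0 ×ˢ univ)) {t : ℝ} (ht : t < 0)
    (x : EuclideanSpace ℝ (Fin 3)) :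
    HasFDerivAt (uncurry u) (fderiv ℝ (uncurry u) (t, x)) (t, x) := by
  have hO : IsOpen (Iio (0 : ℝ) ×ˢ (univ : Set (EuclideanSpace ℝ (Fin 3)))) :=
    isOpen_Iio.prod isOpen_univ
  have hmem : ((t, x) : ℝ × EuclideanSpace ℝ (Fin 3)) ∈
      Iio (0 : ℝ) ×ˢ (univ : Set (EuclideanSpace ℝ (Fin 3))) :=
    mk_mem_prod ht (mem_univ _)
  exact ((h.contDiffAt (hO.mem_nhds hmem)).differentiableAt one_ne_zero).hasFDerivAt

/-- On the open slab the time derivative is the partial derivative `D(uncurry u)(t, x)(1, 0)`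
(chain rule along `s ↦ (s, x)`). [folklore] -/
private theorem solitonBridge_orbit_timeDeriv_eq
    {u : ℝ → EuclideanSpace ℝ (Fin 3) → EuclideanSpace ℝ (Fin 3)}
    (h : ContDiffOn ℝ 1 (uncurry u) (Iio 0 ×ˢ univ)) {t : ℝ} (ht : t < 0)
    (x : EuclideanSpace ℝ (Fin 3)) :
    timeDeriv u t x =
      fderiv ℝ (uncurry u) (t, x) ((1 : ℝ), (0 : EuclideanSpace ℝ (Fin 3))) := by
  have h1 : HasDerivAt (fun s : ℝ => ((s, x) : ℝ × EuclideanSpace ℝ (Fin 3)))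
      ((1 : ℝ), (0 : EuclideanSpace ℝ (Fin 3))) t :=
    (hasDerivAt_id' t).prodMk (hasDerivAt_const t x)
  have h2 := (solitonBridge_orbit_hasFDerivAt_uncurry h ht x).comp_hasDerivAt t h1
  rw [timeDeriv_apply]
  exact h2.deriv

/-- On the open slab the slice derivative is the partial derivative `D(uncurry u)(t, x)(0, w)`
(chain rule along `y ↦ (t, y)`). [folklore] -/
private theorem solitonBridge_orbit_fderiv_slice_eq
    {u : ℝ → EuclideanSpace ℝ (Fin 3) → EuclideanSpace ℝ (Fin 3)}
    (h : ContDiffOn ℝ 1 (uncurry u) (Iio 0 ×ˢ univ)) {t : ℝ} (ht : t < 0)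
    (x w : EuclideanSpace ℝ (Fin 3)) :
    fderiv ℝ (u t) x w = fderiv ℝ (uncurry u) (t, x) ((0 : ℝ), w) := by
  have h1 : HasFDerivAt
      (fun y : EuclideanSpace ℝ (Fin 3) => ((t, y) : ℝ × EuclideanSpace ℝ (Fin 3)))
      (ContinuousLinearMap.inr ℝ ℝ (EuclideanSpace ℝ (Fin 3))) x :=
    hasFDerivAt_prodMk_right t x
  have h2 : HasFDerivAt (u t) ((fderiv ℝ (uncurry u) (t, x)).comp
      (ContinuousLinearMap.inr ℝ ℝ (EuclideanSpace ℝ (Fin 3)))) x :=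
    (solitonBridge_orbit_hasFDerivAt_uncurry h ht x).comp x h1
  rw [h2.fderiv]
  rfl

/-- The spiral curve `μ ↦ R(−2α log μ) w` has velocity `(−2α) • J w` at `μ = 1`. [folklore] -/
private theorem solitonBridge_orbit_hasDerivAt_rotZ_log (α : ℝ) (w : EuclideanSpace ℝ (Fin 3)) :
    HasDerivAt (fun μ : ℝ => rotZ (-(2 * α * Real.log μ)) w) ((-(2 * α)) • rotGen w) 1 := by
  have hθ : HasDerivAt (fun μ : ℝ => -(2 * α * Real.log μ)) (-(2 * α)) 1 := by
    have h := ((Real.hasDerivAt_log (one_ne_zero : (1 : ℝ) ≠ 0)).const_mul (2 * α)).fun_neg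
    simpa using h
  have hR : HasDerivAt (fun θ : ℝ => rotZ θ w) (rotGen w) 0 := hasDerivAt_rotZ_zero w
  exact hR.scomp_of_eq (1 : ℝ) hθ (by simp)

/-- **Derivative along the spiral-scaling orbit at the identity.** For a field jointly `C¹` on
the open slab, `t < 0` and `x ∈ ℝ³`, the curve `μ ↦ μ • u(μ² t, μ • R(−2α log μ) x)` has
derivative `D(u t)(x)[x + A x] + u t x + 2t ∂ₜu(t, x)` at `μ = 1`, `A = (−2α) J`. [folklore] -/
private theorem solitonBridge_orbit_hasDerivAt_inner
    {u : ℝ → EuclideanSpace ℝ (Fin 3) → EuclideanSpace ℝ (Fin 3)}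
    (h : ContDiffOn ℝ 1 (uncurry u) (Iio 0 ×ˢ univ)) (α : ℝ) {t : ℝ} (ht : t < 0)
    (x : EuclideanSpace ℝ (Fin 3)) :
    HasDerivAt (fun μ : ℝ => μ • u (μ ^ 2 * t) (μ • rotZ (-(2 * α * Real.log μ)) x))
      (fderiv ℝ (u t) x (x + ((-(2 * α)) • rotGenL) x) + u t x + (2 * t) • timeDeriv u t x)
      1 := by
  -- the curve `μ ↦ (μ² t, μ • R(−2α log μ) x)` through `(t, x)` at `μ = 1`
  have hc1 : HasDerivAt (fun m : ℝ => m ^ 2 * t) (2 * t) 1 := by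
    simpa using (hasDerivAt_pow 2 (1 : ℝ)).mul_const t
  have hc2 : HasDerivAt (fun m : ℝ => m • rotZ (-(2 * α * Real.log m)) x)
      (x + ((-(2 * α)) • rotGenL) x) 1 := by
    have h2 : HasDerivAt (fun m : ℝ => m • rotZ (-(2 * α * Real.log m)) x)
        ((1 : ℝ) • ((-(2 * α)) • rotGen x) + (1 : ℝ) • rotZ (-(2 * α * Real.log 1)) x) 1 :=
      (hasDerivAt_id' (1 : ℝ)).smul (solitonBridge_orbit_hasDerivAt_rotZ_log α x)
    refine h2.congr_deriv ?_
    rw [one_smul, one_smul, Real.log_one, mul_zero, neg_zero, rotZ_zero, add_comm]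
    rfl
  have hc : HasDerivAt
      (fun m : ℝ => ((m ^ 2 * t, m • rotZ (-(2 * α * Real.log m)) x) :
        ℝ × EuclideanSpace ℝ (Fin 3)))
      ((2 * t, x + ((-(2 * α)) • rotGenL) x) : ℝ × EuclideanSpace ℝ (Fin 3)) 1 :=
    hc1.prodMk hc2
  have hd : HasFDerivAt (uncurry u) (fderiv ℝ (uncurry u) (t, x))
      (((1 : ℝ) ^ 2 * t, (1 : ℝ) • rotZ (-(2 * α * Real.log 1)) x) :
        ℝ × EuclideanSpace ℝ (Fin 3)) := by
    rw [one_pow, one_mul, Real.log_one, mul_zero, neg_zero, rotZ_zero, one_smul]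
    exact solitonBridge_orbit_hasFDerivAt_uncurry h ht x
  have hcomp := hd.comp_hasDerivAt (1 : ℝ) hc
  have hg : HasDerivAt (fun μ : ℝ => μ • u (μ ^ 2 * t) (μ • rotZ (-(2 * α * Real.log μ)) x))
      ((1 : ℝ) • fderiv ℝ (uncurry u) (t, x)
          ((2 * t, x + ((-(2 * α)) • rotGenL) x) : ℝ × EuclideanSpace ℝ (Fin 3))
        + (1 : ℝ) • u ((1 : ℝ) ^ 2 * t) ((1 : ℝ) • rotZ (-(2 * α * Real.log 1)) x)) 1 :=
    (hasDerivAt_id' (1 : ℝ)).smul hcomp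
  refine hg.congr_deriv ?_
  have hsplit : ((2 * t, x + ((-(2 * α)) • rotGenL) x) : ℝ × EuclideanSpace ℝ (Fin 3)) =
      (2 * t) • ((1 : ℝ), (0 : EuclideanSpace ℝ (Fin 3)))
        + ((0 : ℝ), x + ((-(2 * α)) • rotGenL) x) := by
    ext <;> simp
  rw [hsplit, map_add, map_smul, ← solitonBridge_orbit_timeDeriv_eq h ht,
    ← solitonBridge_orbit_fderiv_slice_eq h ht, one_smul, one_smul, one_pow, one_mul,
    Real.log_one, mul_zero, neg_zero, rotZ_zero, one_smul]
  abel

/-! ## The orbit of the spiral-scaling group has zero derivative -/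

/-- **The full orbit is stationary at the identity.** If `u` is jointly `C¹` on the open slab and
satisfies the generator clause `D(u t)(x)[x + A x] + u t x + 2t ∂ₜu − A (u t x) = 0`,
`A = (−2α) J`, at `(t, x)` with `t < 0`, then the orbit
`ν ↦ R(2α log ν) (ν • u(ν² t, ν • R(−2α log ν) x))` has derivative `0` at `ν = 1` (the velocity
`2α J (u t x)` of the outer rotation cancels `−A (u t x)`). [folklore] -/
private theorem solitonBridge_orbit_hasDerivAt_one
    {u : ℝ → EuclideanSpace ℝ (Fin 3) → EuclideanSpace ℝ (Fin 3)}
    (h : ContDiffOn ℝ 1 (uncurry u) (Iio 0 ×ˢ univ)) (α : ℝ) {t : ℝ} (ht : t < 0)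
    (x : EuclideanSpace ℝ (Fin 3))
    (hL : fderiv ℝ (u t) x (x + ((-(2 * α)) • rotGenL) x) + u t x + (2 * t) • timeDeriv u t x
      - ((-(2 * α)) • rotGenL) (u t x) = 0) :
    HasDerivAt (fun ν : ℝ => rotZ (2 * α * Real.log ν)
      (ν • u (ν ^ 2 * t) (ν • rotZ (-(2 * α * Real.log ν)) x))) 0 1 := by
  have h2 := solitonBridge_orbit_hasDerivAt_spiral α (solitonBridge_orbit_hasDerivAt_inner h α ht x)
  refine h2.congr_deriv ?_
  rw [sub_eq_zero] at hL
  rw [hL]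
  simp [Real.log_one]

/-- **The group law of the spiral-scaling orbit.** For `μ₀, ν > 0` the orbit through `(t, x)` at
`μ₀ν` is `R(2α log μ₀) (μ₀ • ·)` of the orbit at `ν` through the moved point
`(μ₀² t, μ₀ R(−2α log μ₀) x)` (`log(μ₀ν) = log μ₀ + log ν`, rotations about `e₃` add angles and
commute with scalars). [folklore] -/
private theorem solitonBridge_orbit_group (α : ℝ)
    (u : ℝ → EuclideanSpace ℝ (Fin 3) → EuclideanSpace ℝ (Fin 3)) (t : ℝ)
    (x : EuclideanSpace ℝ (Fin 3)) {μ₀ ν : ℝ} (hμ₀ : 0 < μ₀) (hν : 0 < ν) :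
    rotZ (2 * α * Real.log (μ₀ * ν)) ((μ₀ * ν) • u ((μ₀ * ν) ^ 2 * t)
        ((μ₀ * ν) • rotZ (-(2 * α * Real.log (μ₀ * ν))) x)) =
      rotZ (2 * α * Real.log μ₀) (μ₀ • rotZ (2 * α * Real.log ν) (ν • u (ν ^ 2 * (μ₀ ^ 2 * t))
        (ν • rotZ (-(2 * α * Real.log ν)) (μ₀ • rotZ (-(2 * α * Real.log μ₀)) x)))) := by
  rw [Real.log_mul hμ₀.ne' hν.ne']
  have e1 : (μ₀ * ν) ^ 2 * t = ν ^ 2 * (μ₀ ^ 2 * t) := by ring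
  have e2 : (μ₀ * ν) • rotZ (-(2 * α * (Real.log μ₀ + Real.log ν))) x =
      ν • rotZ (-(2 * α * Real.log ν)) (μ₀ • rotZ (-(2 * α * Real.log μ₀)) x) := by
    rw [solitonBridge_orbit_rotZ_smul, smul_smul, ← rotZ_add, mul_comm μ₀ ν]
    congr 2
    ring
  rw [e1, e2, solitonBridge_orbit_rotZ_smul (2 * α * Real.log ν), smul_smul,
    solitonBridge_orbit_rotZ_smul (2 * α * Real.log μ₀), ← rotZ_add,
    solitonBridge_orbit_rotZ_smul]
  congr 1
  ring

/-- **The orbit is stationary everywhere.** If `u` is jointly `C¹` on the open slab and satisfies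
the generator clause at every `(t, x)` with `t < 0`, then for `t < 0`, `x ∈ ℝ³` the orbit
`μ ↦ R(2α log μ) (μ • u(μ² t, μ • R(−2α log μ) x))` has derivative `0` at every `μ₀ > 0`
(transport the computation at the identity to `μ₀` by the group law and the chain rule
`ν = μ/μ₀`; the clause is used at the moved point). [folklore] -/
private theorem solitonBridge_orbit_hasDerivAt
    {u : ℝ → EuclideanSpace ℝ (Fin 3) → EuclideanSpace ℝ (Fin 3)}
    (h : ContDiffOn ℝ 1 (uncurry u) (Iio 0 ×ˢ univ)) (α : ℝ)
    (hL : ∀ t < 0, ∀ x : EuclideanSpace ℝ (Fin 3),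
      fderiv ℝ (u t) x (x + ((-(2 * α)) • rotGenL) x) + u t x + (2 * t) • timeDeriv u t x
        - ((-(2 * α)) • rotGenL) (u t x) = 0)
    {t : ℝ} (ht : t < 0) (x : EuclideanSpace ℝ (Fin 3)) {μ₀ : ℝ} (hμ₀ : 0 < μ₀) :
    HasDerivAt (fun μ : ℝ => rotZ (2 * α * Real.log μ)
      (μ • u (μ ^ 2 * t) (μ • rotZ (-(2 * α * Real.log μ)) x))) 0 μ₀ := by
  set g : ℝ → EuclideanSpace ℝ (Fin 3) := fun μ : ℝ => rotZ (2 * α * Real.log μ)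
      (μ • u (μ ^ 2 * t) (μ • rotZ (-(2 * α * Real.log μ)) x)) with hg
  -- the moved point
  have ht' : μ₀ ^ 2 * t < 0 := mul_neg_of_pos_of_neg (pow_pos hμ₀ 2) ht
  have h1 := solitonBridge_orbit_hasDerivAt_one h α ht' (μ₀ • rotZ (-(2 * α * Real.log μ₀)) x)
    (hL _ ht' _)
  have h2 := solitonBridge_orbit_hasDerivAt_rotZ_const (2 * α * Real.log μ₀) (h1.const_smul μ₀)
  -- the orbit at `μ₀ν` near `ν = 1`
  have heq : (fun ν : ℝ => g (μ₀ * ν)) =ᶠ[𝓝 1] fun ν : ℝ => rotZ (2 * α * Real.log μ₀)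
      (μ₀ • rotZ (2 * α * Real.log ν) (ν • u (ν ^ 2 * (μ₀ ^ 2 * t))
        (ν • rotZ (-(2 * α * Real.log ν)) (μ₀ • rotZ (-(2 * α * Real.log μ₀)) x)))) :=
    eventuallyEq_of_mem (Ioi_mem_nhds one_pos) fun ν hν =>
      solitonBridge_orbit_group α u t x hμ₀ hν
  have h3 : HasDerivAt (fun ν : ℝ => g (μ₀ * ν)) 0 1 := by
    refine (h2.congr_of_eventuallyEq heq).congr_deriv ?_
    rw [smul_zero]
    ext i
    fin_cases i <;> simp [rotZ]
  -- chain rule with `ν = μ / μ₀`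
  have h4 : HasDerivAt (fun μ : ℝ => μ / μ₀) (1 / μ₀) μ₀ := (hasDerivAt_id' μ₀).div_const μ₀
  have h5 := h3.scomp_of_eq μ₀ h4 (by field_simp)
  have hcomp : ((fun ν : ℝ => g (μ₀ * ν)) ∘ fun μ : ℝ => μ / μ₀) = g := by
    funext μ
    simp only [Function.comp_def]
    congr 1
    field_simp
  rw [hcomp, smul_zero] at h5
  exact h5

/-- **Integrating the clause: spiral-scaling invariance.** Under the hypotheses of
`solitonBridge_orbit_hasDerivAt`, `R(2α log μ) (μ • u(μ² t, μ • R(−2α log μ) x)) = u(t, x)` for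
every `μ > 0`, `t < 0`, `x` (the orbit is constant on the connected open set `(0, ∞)`).
[folklore] -/
private theorem solitonBridge_orbit_invariance
    {u : ℝ → EuclideanSpace ℝ (Fin 3) → EuclideanSpace ℝ (Fin 3)}
    (h : ContDiffOn ℝ 1 (uncurry u) (Iio 0 ×ˢ univ)) (α : ℝ)
    (hL : ∀ t < 0, ∀ x : EuclideanSpace ℝ (Fin 3),
      fderiv ℝ (u t) x (x + ((-(2 * α)) • rotGenL) x) + u t x + (2 * t) • timeDeriv u t x
        - ((-(2 * α)) • rotGenL) (u t x) = 0)
    {t : ℝ} (ht : t < 0) (x : EuclideanSpace ℝ (Fin 3)) {μ : ℝ} (hμ : 0 < μ) :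
    rotZ (2 * α * Real.log μ) (μ • u (μ ^ 2 * t) (μ • rotZ (-(2 * α * Real.log μ)) x)) =
      u t x := by
  set g : ℝ → EuclideanSpace ℝ (Fin 3) := fun μ : ℝ => rotZ (2 * α * Real.log μ)
      (μ • u (μ ^ 2 * t) (μ • rotZ (-(2 * α * Real.log μ)) x)) with hg
  have hder : ∀ m ∈ Ioi (0 : ℝ), HasDerivAt g 0 m :=
    fun m hm => solitonBridge_orbit_hasDerivAt h α hL ht x hm
  have hdiff : DifferentiableOn ℝ g (Ioi 0) :=
    fun m hm => (hder m hm).differentiableAt.differentiableWithinAt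
  have hd0 : (Ioi (0 : ℝ)).EqOn (deriv g) 0 := fun m hm => (hder m hm).deriv
  have key := isOpen_Ioi.is_const_of_deriv_eq_zero isPreconnected_Ioi hdiff hd0 hμ
    (zero_lt_one : (0 : ℝ) < 1)
  change g μ = u t x
  rw [key, hg]
  simp

/-! ## The registered stub -/

/-- **Stub `solitonBridge_pvAnsatz_of_generator` (SB4a) — the generator clause integrates to the
RSS ansatz.** A rate-class field `u ∈ A_C` (`IsTypeIAncientMild C u`) annihilated at every
`(t, x)`, `t < 0`, by the spiral-scaling generator,
`D(u t)(x)[x + A x] + u t x + 2t ∂ₜu(t, x) − A (u t x) = 0`, `A = (−2α) • rotGenL`, is the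
Pineau–Vicol rotated self-similar ansatz field of its slice `U = u(−1, ·)`:
`u(t, x) = (−t)^{−1/2} R(αs) U(R(−αs) x/√(−t))`, `s = −log(−t)` ((1.7)), i.e.
`u t x = pvAnsatz α (fun y _ => u (-1) y) t x` for `t < 0` (invariance under the spiral-scaling
group, evaluated at `μ = (−t)^{−1/2}`). [cite: PineauVicol2026, (1.7) and §1.2 (arXiv:2607.09619 p. 3)] -/
theorem solitonBridge_pvAnsatz_of_generator : ∀ (C α : ℝ) (u : ℝ → EuclideanSpace ℝ (Fin 3) → EuclideanSpace ℝ (Fin 3)), Literature.Analysis.FluidPDE.IsTypeIAncientMild C u → (∀ t < 0, ∀ x : EuclideanSpace ℝ (Fin 3), fderiv ℝ (u t) x (x + ((-(2 * α)) • Literature.Analysis.FluidPDE.rotGenL) x) + u t x + (2 * t) • Literature.Analysis.FluidPDE.timeDeriv u t x - ((-(2 * α)) • Literature.Analysis.FluidPDE.rotGenL) (u t x) = 0) → ∀ t < 0, ∀ x : EuclideanSpace ℝ (Fin 3), u t x = Literature.Analysis.FluidPDE.pvAnsatz α (fun y _ => u (-1) y) t x := by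
  intro C α u hu hL t ht x
  have h1 : ContDiffOn ℝ 1 (uncurry u) (Iio 0 ×ˢ univ) :=
    hu.contDiffOn.of_le (by exact_mod_cast le_top)
  have hnt : 0 < -t := neg_pos.2 ht
  have hμ : 0 < (Real.sqrt (-t))⁻¹ := inv_pos.2 (Real.sqrt_pos.2 hnt)
  have key := solitonBridge_orbit_invariance h1 α hL ht x hμ
  have hct : ((Real.sqrt (-t))⁻¹) ^ 2 * t = -1 := by
    rw [inv_pow, Real.sq_sqrt hnt.le, inv_mul_eq_div, div_neg, div_self ht.ne]
  have hθ : 2 * α * Real.log (Real.sqrt (-t))⁻¹ = α * -Real.log (-t) := by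
    rw [Real.log_inv, Real.log_sqrt hnt.le]
    ring
  rw [hct, hθ] at key
  rw [← key]
  simp only [pvAnsatz, solitonBridge_orbit_rotZ_smul]

end Summit.NavierStokesRegularity.NavierStokesRegularity.Theorems

end
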